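import Summits.NavierStokesRegularity.FluidComputer.DesignedBlowupEnergyClass
import Literature.Analysis.FluidPDE.ForcedSymmetryPreservation

/-!
# Designed blow-ups inherit every isometry symmetry of their datum and force

Cell `ns-blowup`, seat `ns-blowup-lean` (g8); companion of `PalasekTowerStageSymmetry.lean` (the same
statement for `Stage` / `Realisation`) and of `DesignedBlowupClayBridge.lean` (ecbridge-1's
DESIGN-FIRST (C)-bridge vocabulary: `DesignedBlowup ν` = a maximal smooth solution of the forced system
with Clay datum and force, finite energy and a uniform speed bound on every closed sub-slab; the
∃-ladder form `navierStokesBreakdownR3_of_window_solutions`, p434821, is phrased over it). LABEL: E–C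
typing (KERNEL bookkeeping; theorems only, no definition, no named fact, no hypothesis `hU`). WHAT THIS
IS NOT: not Navier–Stokes evidence — constraints every INHABITANT of the type `DesignedBlowup` must
satisfy; nothing is constructed, asserted or refuted.

* `DesignedBlowup.memLp_datum` — the `H¹` datum (the closed sub-slabs are the tree's
  `DesignedBlowup.classical_Icc`, `DesignedBlowupEnergyClass.lean`);
* `DesignedBlowup.conj_eq` — a linear isometry `R` of `ℝ³` fixing `D.u 0` and fixing `D.f t` for
  `t ∈ [0, T)` fixes `D.u t` for every `t ∈ [0, T)` (`IsClassicalNSSolutionOn.conj_eq_of_clayForce` on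
  each closed sub-slab `[0, t]`, where the design has finite energy: conjugation covariance +
  Tao 2013 Cor. 11.4 WITH a Clay-class force);
* `DesignedBlowup.isAxisymmetric`, `DesignedBlowup.hasNoSwirl` — axisymmetric (swirl-free) data and
  forces give axisymmetric (swirl-free) designs: the planner's design-relativised forms (v2.4′ (r2)/(r4),
  STATUS l.3175 / l.3347) quantify over designs, and a design class cut out by isometries is
  HEREDITARY in time along the design's own flow.

References: A. J. Majda, A. L. Bertozzi, *Vorticity and Incompressible Flow*, CUP 2002, §1.2
Prop. 1.1 (iii), §2.3.3 (2.52)–(2.53) [cite: MajdaBertozziCUP2002, §2.3.3]; T. Tao, Anal. PDE 6 (2013),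
Cor. 11.4 [cite: Tao2011, Cor. 11.4]; P. G. Lemarié-Rieusset, CRC Press 2016, §10.3 (10.20)–(10.21)
[cite: LemarieRieusset2016, §10.3].
-/

noncomputable section

namespace Summit.NavierStokesRegularity.FluidComputer

open Set MeasureTheory Filter Topology Function
open scoped ENNReal ContDiff NNReal
open Literature.Analysis.FluidPDE
open Summit.NavierStokesRegularity.NavierStokesRegularity

namespace DesignedBlowup

variable {ν : ℝ} (D : DesignedBlowup ν)

/-- The datum of a designed blow-up is `H¹`: `u 0, ∇(u 0) ∈ L²` (Clay decay (4) and smoothness of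
the slice `t = 0`). [folklore] -/
theorem memLp_datum : MemLp (D.u 0) 2 volume ∧ MemLp (fderiv ℝ (D.u 0)) 2 volume :=
  Theorems.ClayUniqueness.memLp_two_of_rapidDecay D.datum_decay
    (D.contDiff_datum.of_le (by norm_cast))

/-- **A designed blow-up inherits every isometry symmetry of its datum and force** on `[0, T)`: for
`ν > 0` and a linear isometry `R` of `ℝ³` with `R (D.u 0 (R⁻¹ x)) = D.u 0 x` and
`R (D.f t (R⁻¹ x)) = D.f t x` for `t ∈ [0, T)`: `R (D.u t (R⁻¹ x)) = D.u t x` for every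
`t ∈ [0, T)` (conjugation covariance + forced finite-energy uniqueness on each closed sub-slab).
[cite: MajdaBertozziCUP2002, §1.2 Prop. 1.1 (iii); Tao2011, Cor. 11.4] -/
theorem conj_eq (hν : 0 < ν)
    (Rot : EuclideanSpace ℝ (Fin 3) ≃ₗᵢ[ℝ] EuclideanSpace ℝ (Fin 3))
    (h0 : ∀ x, Rot (D.u 0 (Rot.symm x)) = D.u 0 x)
    (hf : ∀ t ∈ Ico 0 D.T, ∀ x, Rot (D.f t (Rot.symm x)) = D.f t x) :
    ∀ t ∈ Ico 0 D.T, ∀ x, Rot (D.u t (Rot.symm x)) = D.u t x := by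
  intro t ht x
  rcases ht.1.eq_or_lt with h | h
  · rw [← h]
    exact h0 x
  · exact (D.classical_Icc h ht.2).conj_eq_of_clayForce Rot hν h D.memLp_datum.1 D.memLp_datum.2
      D.force_smooth D.force_decay rfl (D.energy t ht.2)
      (fun r hr y => hf r ⟨hr.1, hr.2.trans_lt ht.2⟩ y) h0 t ⟨h.le, le_rfl⟩ x

/-- **Designs from axisymmetric data under axisymmetric forces are axisymmetric** on `[0, T)`.
[cite: MajdaBertozziCUP2002, §2.3.3 (2.52)–(2.53); Tao2011, Cor. 11.4] -/
theorem isAxisymmetric (hν : 0 < ν) (h0A : IsAxisymmetric (D.u 0))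
    (hfA : ∀ t ∈ Ico 0 D.T, IsAxisymmetric (D.f t)) :
    ∀ t ∈ Ico 0 D.T, IsAxisymmetric (D.u t) := by
  intro t ht
  rw [isAxisymmetric_iff_conj_rotZLIE]
  intro θ x
  exact D.conj_eq hν (rotZLIE θ) ((isAxisymmetric_iff_conj_rotZLIE (D.u 0)).1 h0A θ)
    (fun r hr y => (isAxisymmetric_iff_conj_rotZLIE (D.f r)).1 (hfA r hr) θ y) t ht x

/-- **Designs from axisymmetric swirl-free data under axisymmetric swirl-free forces have no swirl**
on `[0, T)` (meridian reflection). [cite: LemarieRieusset2016, §10.3 (10.20)–(10.21), p. 284; Tao2011, Cor. 11.4] -/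
theorem hasNoSwirl (hν : 0 < ν) (h0A : IsAxisymmetric (D.u 0)) (h0S : HasNoSwirl (D.u 0))
    (hfA : ∀ t ∈ Ico 0 D.T, IsAxisymmetric (D.f t)) (hfS : ∀ t ∈ Ico 0 D.T, HasNoSwirl (D.f t)) :
    ∀ t ∈ Ico 0 D.T, HasNoSwirl (D.u t) := by
  intro t ht
  exact (D.isAxisymmetric hν h0A hfA t ht).hasNoSwirl_of_conj_reflY_eq
    (D.conj_eq hν reflY (h0A.conj_reflY_eq h0S)
      (fun r hr y => (hfA r hr).conj_reflY_eq (hfS r hr) y) t ht)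

/-- Whole-half-line form: an axisymmetric swirl-free datum and a force axisymmetric without swirl on
all of `[0, ∞)` give a design axisymmetric without swirl at every `t ∈ [0, T)`.
[cite: LemarieRieusset2016, §10.3 (10.20)–(10.21), p. 284] -/
theorem axisymNoSwirl_of_design (hν : 0 < ν) (h0A : IsAxisymmetric (D.u 0))
    (h0S : HasNoSwirl (D.u 0)) (hfA : ∀ t, 0 ≤ t → IsAxisymmetric (D.f t))
    (hfS : ∀ t, 0 ≤ t → HasNoSwirl (D.f t)) :
    ∀ t ∈ Ico 0 D.T, IsAxisymmetric (D.u t) ∧ HasNoSwirl (D.u t) :=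
  fun t ht => ⟨D.isAxisymmetric hν h0A (fun r hr => hfA r hr.1) t ht,
    D.hasNoSwirl hν h0A h0S (fun r hr => hfA r hr.1) (fun r hr => hfS r hr.1) t ht⟩

end DesignedBlowup

end Summit.NavierStokesRegularity.FluidComputer

end
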